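/-
Copyright (c) 2026 the pub-hodgecm-mathlib formalisation cell (harness21).  Prover seat hodgecm-mathlib-K2E3-p11 (g4),
Track B «K2-LIT» ∕ h413 (`stmt-HodgeConjecture-24833`), line `K2_E3_EllipticInputs`, unit U12 §SC (SC-an), road «FC» (finite conjugation measure,
(SC-an) lead K2E3-p14 (g4) RULINGS #15), brick (FC-B) «DOUBLE COSET ∕ BOX MEASURE» — deal D52 (dealer K2E3-plan (g3)).  2026-09-04.
-/
import Mathlib.MeasureTheory.Group.Measure
import Mathlib.MeasureTheory.Group.Action
import Mathlib.MeasureTheory.Measure.Haar.Basic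
import Mathlib.MeasureTheory.Measure.Prod
import Mathlib.Topology.Algebra.Group.Pointwise
import HarnessLib

/-!
# K2_E3 road (h413), §SC (SC-an), road «FC» — brick (FC-B): the DOUBLE-COSET IDENTITY and the BOX BOUND

Cell `pub/hodgecm-mathlib` (D-0151), Track B (21-frontier RULING «PUSH BOTH» 2026-09-03, director req624), seat K2E3-p11 (g4), deal D52 of dealer K2E3-plan (g3)
(2026-09-04T03:45Z) on the (SC-an) lead K2E3-p14 (g4)'s road «FC» (RULINGS #15, (R15-3)).  `--supports stmt-HodgeConjecture-24833 --as helper`; THEOREMS ONLY (no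
definition ∕ instance ∕ notation ∕ named fact ∕ `sorry`); never imports `Cruxes/…/Lines`; GENERIC (any second countable locally compact group), no model objects.
COUNT-NEUTRAL: (SC-an) `sig_K2E3SupercuspidalTruncatedCharAnalytic` (U12 :255) stays OPEN; this brick serves step (ii) of the lead's (FC) estimate
`Σ_d μ(K₀ t_d K₀) · μ(box_d) · (collision probability) < ∞`.

THE MATHEMATICS (folklore bookkeeping with compact-open subgroups; [Cartier1979, §I.3–I.4; BushnellHenniart2006, §4.1] for the double-coset calculus).
Let `G` be a locally compact, second countable group with a left Haar measure `μ`, `K ≤ G` an OPEN subgroup, `t ∈ G`.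
* §1 (ii of the deal) **BOX BOUND.**  For `a, b ∈ G` the set `aK ∩ t⁻¹(bK)t` is empty or ONE left coset `g₀ · (K ∩ t⁻¹Kt)`, so `μ(aK ∩ t⁻¹ bK t) ≤ μ(K ∩ t⁻¹Kt)`
  (`measure_leftCoset_inter_conj_leftCoset_le`); hence if `Ω ⊆ ⋃_{f ∈ F} fK` for a finite `F`, then
  **`μ(Ω ∩ t⁻¹Ωt) ≤ |F|² · μ(K ∩ t⁻¹Kt)`** (`measure_inter_conjPreimage_le_card_sq_mul`) — `Ω ∩ t⁻¹Ωt ⊆ ⋃_{(f,f′) ∈ F²} (fK ∩ t⁻¹f′Kt)`.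
  Here `t⁻¹ S t` is spelled as the preimage `{g | t * g * t⁻¹ ∈ S}`.
* §2 (i of the deal) **DOUBLE-COSET IDENTITY.**  **`μ(K t K) · μ(K ∩ tKt⁻¹) = μ(K)²`** (`measure_doubleCoset_mul_measure_inter_conj`, an EQUALITY), by Tonelli on
  `E = {(x, k) : k ∈ K, t⁻¹k⁻¹x ∈ K} ⊆ G × G`: the `k`-sections are the cosets `k t K` (mass `μ K` each, for `k ∈ K`), the `x`-sections are `k₀ · (K ∩ tKt⁻¹)`
  for `x = k₀ t k₁ ∈ KtK` and `∅` off `KtK` — no coset representatives and no index arithmetic.  Second countability makes `(x,k) ↦ t⁻¹k⁻¹x` product-measurable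
  and `μ` s-finite.  With `μ` also RIGHT invariant (unimodular `G`, e.g. reductive `p`-adic groups) the conjugate version
  **`μ(K t K) · μ(K ∩ t⁻¹Kt) = μ(K)²`** (`measure_doubleCoset_mul_measure_inter_conj'`) follows from `μ(K ∩ tKt⁻¹) = μ(K ∩ t⁻¹Kt)` (§2 `measure_inter_conj_eq`).
* §3 **THE BOX COROLLARY** used by (FC-8): `μ(K t K) · μ(Ω ∩ t⁻¹Ωt) ≤ |F|² · μ(K)²` (`measure_doubleCoset_mul_measure_box_le`), uniformly in `t`.
* §4 (ED. 2) **`K`-BI-INVARIANT BOXES**: for `Ω` with `kΩ = Ω = Ωk` (`k ∈ K`) and `x ∈ K t K`, `μ(Ω ∩ x⁻¹Ωx) = μ(Ω ∩ t⁻¹Ωt)` (conjugation by `k₁ ∈ K`,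
  unimodularity), hence for `A, S ⊆ Ω`: `μ(K t K) · sup_{x ∈ KtK} μ(A ∩ x⁻¹Sx) ≤ |F|² · μ(K)²` (`measure_doubleCoset_mul_iSup_le`) — the `d`-th term of the
  (FC-8a) skeleton ★ K2E3-p23 (g4) `∑' d, μ (D d) * ⨆ x ∈ D d, μ (A ∩ {g | x * g * x⁻¹ ∈ S})` with `D d = K t_d K`.
NOT here: the Cartan decomposition `U = ⋃_d K₀ t_d K₀`, the covering number `N_M` of `Ω_M`, compactness of `K` (only openness and the invariances are used;
finiteness of `μ K` is the consumer's `IsCompact.measure_lt_top`).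

HONEST LABEL: HC_CM is proved only modulo the 7 printed citations (2 remaining named inputs: hLiu418 = stmt-HodgeConjecture-24832, h413 = stmt-HodgeConjecture-24833)
until rung 0 closes; count-neutral helper.
-/

set_option autoImplicit false
set_option linter.dupNamespace false   -- `Summit.HodgeConjecture.HodgeConjecture.…` (D-0017 nested layout; lakefile exemption for Summits)

noncomputable section

open MeasureTheory MeasureTheory.Measure Set
open scoped ENNReal Pointwise

namespace Summit.HodgeConjecture.HodgeConjecture.Cruxes.H413.K2E3DoubleCosetBoxMeasure

variable {G : Type*} [Group G] [MeasurableSpace G] (μ : Measure G)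

/-! ## §1  The box bound `μ(Ω ∩ t⁻¹Ωt) ≤ |F|² · μ(K ∩ t⁻¹Kt)` -/

section Box

/-- **One left coset at a time**: for an arbitrary subgroup `K`, `aK ∩ t⁻¹(bK)t` is empty or a single left coset `g₀ (K ∩ t⁻¹Kt)`, hence (left invariance)
`μ(aK ∩ t⁻¹(bK)t) ≤ μ(K ∩ t⁻¹Kt)`; the conjugate `t⁻¹ S t` is written as the preimage `{g | t g t⁻¹ ∈ S}`.
[cite: Cartier1979, §I.3] -/
theorem measure_leftCoset_inter_conj_leftCoset_le [MeasurableMul G] [μ.IsMulLeftInvariant] (K : Subgroup G) (t a b : G) :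
    μ ((a • (K : Set G)) ∩ {g | t * g * t⁻¹ ∈ b • (K : Set G)}) ≤ μ {k | k ∈ K ∧ t * k * t⁻¹ ∈ K} := by
  rcases Set.eq_empty_or_nonempty ((a • (K : Set G)) ∩ {g | t * g * t⁻¹ ∈ b • (K : Set G)}) with h0 | ⟨g₀, hg₀a, hg₀b⟩
  · rw [h0, measure_empty]
    exact bot_le
  · -- the piece is contained in the left coset `g₀ • (K ∩ t⁻¹Kt)`
    have hsub : (a • (K : Set G)) ∩ {g | t * g * t⁻¹ ∈ b • (K : Set G)} ⊆ g₀ • {k | k ∈ K ∧ t * k * t⁻¹ ∈ K} := by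
      intro g hg
      rcases hg with ⟨hga, hgb⟩
      rw [Set.mem_setOf_eq] at hgb hg₀b
      rw [Set.mem_smul_set_iff_inv_smul_mem, smul_eq_mul] at hga hgb hg₀a hg₀b ⊢
      refine ⟨?_, ?_⟩
      · -- `g₀⁻¹ g = (a⁻¹ g₀)⁻¹ (a⁻¹ g) ∈ K`
        have h := K.mul_mem (K.inv_mem hg₀a) hga
        simpa [mul_assoc] using h
      · -- `t (g₀⁻¹ g) t⁻¹ = (b⁻¹ t g₀ t⁻¹)⁻¹ (b⁻¹ t g t⁻¹) ∈ K`
        have h := K.mul_mem (K.inv_mem hg₀b) hgb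
        simpa [mul_assoc] using h
    calc μ ((a • (K : Set G)) ∩ {g | t * g * t⁻¹ ∈ b • (K : Set G)})
        ≤ μ (g₀ • {k | k ∈ K ∧ t * k * t⁻¹ ∈ K}) := measure_mono hsub
      _ = μ {k | k ∈ K ∧ t * k * t⁻¹ ∈ K} := measure_smul μ g₀ _

/-- **THE BOX BOUND (deal D52 (ii)).**  If `Ω ⊆ ⋃_{f ∈ F} f K` for a finite `F ⊆ G` and a subgroup `K`, then for every `t ∈ G`
`μ(Ω ∩ t⁻¹ Ω t) ≤ |F|² · μ(K ∩ t⁻¹ K t)`: `Ω ∩ t⁻¹Ωt ⊆ ⋃_{(f,f′) ∈ F × F} (fK ∩ t⁻¹ f′K t)` and each piece is empty or one left coset of `K ∩ t⁻¹Kt`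
(`measure_leftCoset_inter_conj_leftCoset_le`).  Conjugates are spelled as preimages `{g | t g t⁻¹ ∈ ·}`.
[cite: Cartier1979, §I.3] [cite: BushnellHenniart2006, §4.1] -/
theorem measure_inter_conjPreimage_le_card_sq_mul [MeasurableMul G] [μ.IsMulLeftInvariant] (K : Subgroup G) (t : G)
    (Ω : Set G) (F : Finset G) (hΩ : Ω ⊆ ⋃ f ∈ F, f • (K : Set G)) :
    μ (Ω ∩ {g | t * g * t⁻¹ ∈ Ω}) ≤ (F.card : ℝ≥0∞) ^ 2 * μ {k | k ∈ K ∧ t * k * t⁻¹ ∈ K} := by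
  -- cover by the `|F|²` pieces
  have hcover : Ω ∩ {g | t * g * t⁻¹ ∈ Ω} ⊆
      ⋃ f ∈ F, ⋃ f' ∈ F, (f • (K : Set G)) ∩ {g | t * g * t⁻¹ ∈ f' • (K : Set G)} := by
    intro g hg
    rcases hg with ⟨hgΩ, hgt⟩
    rw [Set.mem_setOf_eq] at hgt
    obtain ⟨f, hf, hgf⟩ := Set.mem_iUnion₂.1 (hΩ hgΩ)
    obtain ⟨f', hf', hgf'⟩ := Set.mem_iUnion₂.1 (hΩ hgt)
    exact Set.mem_iUnion₂.2 ⟨f, hf, Set.mem_iUnion₂.2 ⟨f', hf', hgf, hgf'⟩⟩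
  calc μ (Ω ∩ {g | t * g * t⁻¹ ∈ Ω})
      ≤ μ (⋃ f ∈ F, ⋃ f' ∈ F, (f • (K : Set G)) ∩ {g | t * g * t⁻¹ ∈ f' • (K : Set G)}) := measure_mono hcover
    _ ≤ ∑ f ∈ F, μ (⋃ f' ∈ F, (f • (K : Set G)) ∩ {g | t * g * t⁻¹ ∈ f' • (K : Set G)}) := measure_biUnion_finset_le F _
    _ ≤ ∑ f ∈ F, ∑ f' ∈ F, μ ((f • (K : Set G)) ∩ {g | t * g * t⁻¹ ∈ f' • (K : Set G)}) :=
        Finset.sum_le_sum fun f _ => measure_biUnion_finset_le F _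
    _ ≤ ∑ f ∈ F, ∑ f' ∈ F, μ {k | k ∈ K ∧ t * k * t⁻¹ ∈ K} :=
        Finset.sum_le_sum fun f _ => Finset.sum_le_sum fun f' _ => measure_leftCoset_inter_conj_leftCoset_le μ K t f f'
    _ = (F.card : ℝ≥0∞) ^ 2 * μ {k | k ∈ K ∧ t * k * t⁻¹ ∈ K} := by
        rw [Finset.sum_const, Finset.sum_const, nsmul_eq_mul, nsmul_eq_mul, sq, mul_assoc]

end Box

/-! ## §2  The double-coset identity `μ(K t K) · μ(K ∩ t K t⁻¹) = μ(K)²` -/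

section DoubleCoset

omit [MeasurableSpace G] in
/-- For `k ∈ K`, the coset `{x | t⁻¹ k⁻¹ x ∈ K}` is `(k t) • K`. [folklore] -/
theorem setOf_mem_eq_smul (K : Subgroup G) (t k : G) :
    {x : G | t⁻¹ * (k⁻¹ * x) ∈ K} = (k * t) • (K : Set G) := by
  ext x
  rw [Set.mem_setOf_eq, Set.mem_smul_set_iff_inv_smul_mem, smul_eq_mul, mul_inv_rev, mul_assoc, SetLike.mem_coe]

omit [MeasurableSpace G] in
/-- For `x = k₀ t k₁` with `k₀, k₁ ∈ K`, the section `{k ∈ K | t⁻¹ k⁻¹ x ∈ K}` is the left coset `k₀ • (K ∩ t K t⁻¹)`. [cite: Cartier1979, §I.3] -/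
theorem setOf_section_eq_smul (K : Subgroup G) (t k₀ k₁ : G) (hk₀ : k₀ ∈ K) (hk₁ : k₁ ∈ K) :
    {k : G | k ∈ K ∧ t⁻¹ * (k⁻¹ * (k₀ * t * k₁)) ∈ K} = k₀ • {u : G | u ∈ K ∧ t⁻¹ * u * t ∈ K} := by
  ext k
  rw [Set.mem_smul_set_iff_inv_smul_mem, smul_eq_mul, Set.mem_setOf_eq, Set.mem_setOf_eq]
  constructor
  · rintro ⟨hk, hx⟩
    refine ⟨K.mul_mem (K.inv_mem hk₀) hk, ?_⟩
    -- `t⁻¹ (k₀⁻¹ k) t = ((t⁻¹ k⁻¹ k₀ t k₁) k₁⁻¹)⁻¹`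
    have h := K.inv_mem (K.mul_mem hx (K.inv_mem hk₁))
    simpa [mul_assoc] using h
  · rintro ⟨hu, hut⟩
    refine ⟨?_, ?_⟩
    · have h := K.mul_mem hk₀ hu
      simpa using h
    · -- `t⁻¹ k⁻¹ k₀ t k₁ = (t⁻¹ (k₀⁻¹ k) t)⁻¹ k₁`
      have h := K.mul_mem (K.inv_mem hut) hk₁
      simpa [mul_assoc] using h

omit [MeasurableSpace G] in
/-- If the section `{k ∈ K | t⁻¹ k⁻¹ x ∈ K}` is non-empty then `x ∈ K t K`. [folklore] -/
theorem mem_doubleCoset_of_section_nonempty (K : Subgroup G) (t x : G)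
    (h : ({k : G | k ∈ K ∧ t⁻¹ * (k⁻¹ * x) ∈ K}).Nonempty) : x ∈ (K : Set G) * {t} * (K : Set G) := by
  obtain ⟨k, hk, hkx⟩ := h
  refine Set.mem_mul.2 ⟨k * t, Set.mem_mul.2 ⟨k, hk, t, Set.mem_singleton t, rfl⟩, t⁻¹ * (k⁻¹ * x), hkx, ?_⟩
  simp [mul_assoc]

omit [MeasurableSpace G] in
/-- Every `x ∈ K t K` is `k₀ t k₁` with `k₀, k₁ ∈ K`. [folklore] -/
theorem exists_eq_mul_mul_of_mem_doubleCoset (K : Subgroup G) (t x : G) (hx : x ∈ (K : Set G) * {t} * (K : Set G)) :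
    ∃ k₀ k₁ : G, k₀ ∈ K ∧ k₁ ∈ K ∧ x = k₀ * t * k₁ := by
  obtain ⟨y, hy, k₁, hk₁, rfl⟩ := Set.mem_mul.1 hx
  obtain ⟨k₀, hk₀, t', ht', rfl⟩ := Set.mem_mul.1 hy
  rw [Set.mem_singleton_iff] at ht'
  subst ht'
  exact ⟨k₀, k₁, hk₀, hk₁, rfl⟩

omit [MeasurableSpace G] in
/-- `K t K` is open when `K` is. [folklore] -/
theorem isOpen_doubleCoset [TopologicalSpace G] [IsTopologicalGroup G] (K : Subgroup G) (hKo : IsOpen (K : Set G)) (t : G) :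
    IsOpen ((K : Set G) * {t} * (K : Set G)) :=
  hKo.mul_left

/-- **THE DOUBLE-COSET IDENTITY (deal D52 (i)).**  For an OPEN subgroup `K` of a second countable locally compact group `G` with left Haar measure `μ` and any
`t ∈ G`:  `μ(K t K) · μ(K ∩ t K t⁻¹) = μ(K)²` — Tonelli on `E = {(x,k) | k ∈ K, t⁻¹k⁻¹x ∈ K}`: integrating out `x` first gives `∫_K μ(k t K) dk = μ(K)²`,
integrating out `k` first gives `∫_{KtK} μ(k₀(K ∩ tKt⁻¹)) dx = μ(KtK) μ(K ∩ tKt⁻¹)` (`setOf_section_eq_smul`).  Classically `[K : K ∩ tKt⁻¹]` cosets of mass `μ(K)`.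
[cite: Cartier1979, §I.3–I.4] [cite: BushnellHenniart2006, §4.1] -/
theorem measure_doubleCoset_mul_measure_inter_conj [TopologicalSpace G] [IsTopologicalGroup G] [BorelSpace G]
    [SecondCountableTopology G] [LocallyCompactSpace G] [μ.IsHaarMeasure]
    (K : Subgroup G) (hKo : IsOpen (K : Set G)) (t : G) :
    μ ((K : Set G) * {t} * (K : Set G)) * μ {k | k ∈ K ∧ t⁻¹ * k * t ∈ K} = μ K ^ 2 := by
  -- the Tonelli set
  set E : Set (G × G) := {p | p.2 ∈ K ∧ t⁻¹ * (p.2⁻¹ * p.1) ∈ K} with hE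
  have hKm : MeasurableSet (K : Set G) := hKo.measurableSet
  have hEm : MeasurableSet E := by
    have h1 : Measurable fun p : G × G => p.2 := measurable_snd
    have h2 : Measurable fun p : G × G => t⁻¹ * (p.2⁻¹ * p.1) :=
      (continuous_const.mul ((continuous_snd.inv).mul continuous_fst)).measurable
    exact (h1 hKm).inter (h2 hKm)
  -- (a) integrate out `x` first: the `k`-section is `k t K` for `k ∈ K`, empty otherwise
  have ha : μ.prod μ E = μ K * μ K := by
    rw [Measure.prod_apply_symm hEm]
    have hsec : ∀ k : G, μ ((fun x => (x, k)) ⁻¹' E) = (K : Set G).indicator (fun _ => μ K) k := by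
      intro k
      by_cases hk : k ∈ K
      · rw [Set.indicator_of_mem hk]
        have hset : (fun x => (x, k)) ⁻¹' E = (k * t) • (K : Set G) := by
          rw [← setOf_mem_eq_smul K t k]
          ext x
          simp [hE, hk]
        rw [hset, measure_smul]
      · rw [Set.indicator_of_notMem hk]
        have hset : (fun x => (x, k)) ⁻¹' E = ∅ := by
          ext x
          simp [hE, hk]
        rw [hset, measure_empty]
    simp_rw [hsec]
    rw [lintegral_indicator_const hKm]
  -- (b) integrate out `k` first: the `x`-section is `k₀ (K ∩ tKt⁻¹)` on `KtK`, empty off it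
  have hb : μ.prod μ E = μ {k | k ∈ K ∧ t⁻¹ * k * t ∈ K} * μ ((K : Set G) * {t} * (K : Set G)) := by
    rw [Measure.prod_apply hEm]
    have hsec : ∀ x : G, μ (Prod.mk x ⁻¹' E) =
        ((K : Set G) * {t} * (K : Set G)).indicator (fun _ => μ {k | k ∈ K ∧ t⁻¹ * k * t ∈ K}) x := by
      intro x
      have hpre : Prod.mk x ⁻¹' E = {k : G | k ∈ K ∧ t⁻¹ * (k⁻¹ * x) ∈ K} := by
        ext k; simp [hE]
      by_cases hx : x ∈ (K : Set G) * {t} * (K : Set G)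
      · rw [Set.indicator_of_mem hx, hpre]
        obtain ⟨k₀, k₁, hk₀, hk₁, rfl⟩ := exists_eq_mul_mul_of_mem_doubleCoset K t x hx
        rw [setOf_section_eq_smul K t k₀ k₁ hk₀ hk₁, measure_smul]
      · rw [Set.indicator_of_notMem hx, hpre]
        have hempty : {k : G | k ∈ K ∧ t⁻¹ * (k⁻¹ * x) ∈ K} = ∅ := by
          by_contra hne
          exact hx (mem_doubleCoset_of_section_nonempty K t x (Set.nonempty_iff_ne_empty.2 hne))
        rw [hempty, measure_empty]
    simp_rw [hsec]
    rw [lintegral_indicator_const (isOpen_doubleCoset K hKo t).measurableSet]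
  rw [mul_comm, ← hb, ha, sq]

/-- **Conjugation invariance of a unimodular Haar measure on the two intersections**: if `μ` is left AND right invariant then
`μ(K ∩ t K t⁻¹) = μ(K ∩ t⁻¹ K t)` (`K ∩ tKt⁻¹` is the preimage of `K ∩ t⁻¹Kt` under `u ↦ t⁻¹ u t`). [folklore] -/
theorem measure_inter_conj_eq [MeasurableMul G] [μ.IsMulLeftInvariant] [μ.IsMulRightInvariant] (K : Subgroup G) (t : G) :
    μ {k | k ∈ K ∧ t⁻¹ * k * t ∈ K} = μ {k | k ∈ K ∧ t * k * t⁻¹ ∈ K} := by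
  have hset : {k : G | k ∈ K ∧ t⁻¹ * k * t ∈ K} =
      (fun u => t⁻¹ * u) ⁻¹' ((fun v => v * t) ⁻¹' {k : G | k ∈ K ∧ t * k * t⁻¹ ∈ K}) := by
    ext k
    simp only [Set.mem_setOf_eq, Set.mem_preimage]
    constructor
    · rintro ⟨hk, hkt⟩
      refine ⟨hkt, ?_⟩
      simpa [mul_assoc] using hk
    · rintro ⟨hkt, hk⟩
      refine ⟨?_, hkt⟩
      simpa [mul_assoc] using hk
  rw [hset, measure_preimage_mul, measure_preimage_mul_right]

/-- **THE DOUBLE-COSET IDENTITY, conjugate version (deal D52 (i′))** for a unimodular Haar measure: `μ(K t K) · μ(K ∩ t⁻¹ K t) = μ(K)²`.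
[cite: Cartier1979, §I.3–I.4] -/
theorem measure_doubleCoset_mul_measure_inter_conj' [TopologicalSpace G] [IsTopologicalGroup G] [BorelSpace G]
    [SecondCountableTopology G] [LocallyCompactSpace G] [μ.IsHaarMeasure] [μ.IsMulRightInvariant]
    (K : Subgroup G) (hKo : IsOpen (K : Set G)) (t : G) :
    μ ((K : Set G) * {t} * (K : Set G)) * μ {k | k ∈ K ∧ t * k * t⁻¹ ∈ K} = μ K ^ 2 := by
  rw [← measure_inter_conj_eq μ K t, measure_doubleCoset_mul_measure_inter_conj μ K hKo t]

end DoubleCoset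

/-! ## §3  The box corollary `μ(K t K) · μ(Ω ∩ t⁻¹ Ω t) ≤ |F|² · μ(K)²` -/

section Corollary

variable [TopologicalSpace G] [IsTopologicalGroup G] [BorelSpace G] [SecondCountableTopology G] [LocallyCompactSpace G]
  [μ.IsHaarMeasure] [μ.IsMulRightInvariant]

/-- **THE BOX COROLLARY (road «FC» step (ii)).**  `G` second countable locally compact UNIMODULAR (`μ` left and right invariant), `K` an open subgroup,
`Ω ⊆ ⋃_{f ∈ F} fK` for a finite `F`: for EVERY `t ∈ G`, `μ(K t K) · μ(Ω ∩ t⁻¹ Ω t) ≤ |F|² · μ(K)²` — uniformly in `t` (the lead's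
«`μ(K₀t_dK₀)·μ(box_d) ≤ N_M² μ(K₀)²` UNIFORMLY in `d`»). [cite: Cartier1979, §I.3–I.4] [cite: BushnellHenniart2006, §4.1] -/
theorem measure_doubleCoset_mul_measure_box_le (K : Subgroup G) (hKo : IsOpen (K : Set G)) (t : G)
    (Ω : Set G) (F : Finset G) (hΩ : Ω ⊆ ⋃ f ∈ F, f • (K : Set G)) :
    μ ((K : Set G) * {t} * (K : Set G)) * μ (Ω ∩ {g | t * g * t⁻¹ ∈ Ω}) ≤ (F.card : ℝ≥0∞) ^ 2 * μ K ^ 2 := by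
  calc μ ((K : Set G) * {t} * (K : Set G)) * μ (Ω ∩ {g | t * g * t⁻¹ ∈ Ω})
      ≤ μ ((K : Set G) * {t} * (K : Set G)) * ((F.card : ℝ≥0∞) ^ 2 * μ {k | k ∈ K ∧ t * k * t⁻¹ ∈ K}) :=
        mul_le_mul' le_rfl (measure_inter_conjPreimage_le_card_sq_mul μ K t Ω F hΩ)
    _ = (F.card : ℝ≥0∞) ^ 2 * (μ ((K : Set G) * {t} * (K : Set G)) * μ {k | k ∈ K ∧ t * k * t⁻¹ ∈ K}) := by ring
    _ = (F.card : ℝ≥0∞) ^ 2 * μ K ^ 2 := by rw [measure_doubleCoset_mul_measure_inter_conj' μ K hKo t]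

end Corollary

/-! ## §4 (ED. 2)  `K`-bi-invariant boxes: the supremum over `x ∈ K t K` (glue to the (FC-8a) skeleton ★ K2E3-p23 (g4)) -/

section BiInvariant

/-- **Moving `x ∈ K t K` to `t`.**  If `Ω` is `K`-bi-invariant (`kΩ = Ω = Ωk` for `k ∈ K`) and `μ` is left and right invariant, then for `x = k₀ t k₁ ∈ K t K`
`μ(Ω ∩ x⁻¹Ωx) = μ(Ω ∩ t⁻¹Ωt)`: `Ω ∩ x⁻¹Ωx = k₁⁻¹ (Ω ∩ t⁻¹Ωt) k₁`. [cite: Cartier1979, §I.3] -/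
theorem measure_inter_conjPreimage_eq_of_mem_doubleCoset [MeasurableMul G] [μ.IsMulLeftInvariant] [μ.IsMulRightInvariant]
    (K : Subgroup G) (t x : G) (hx : x ∈ (K : Set G) * {t} * (K : Set G)) (Ω : Set G)
    (hΩl : ∀ k ∈ K, ∀ g, k * g ∈ Ω ↔ g ∈ Ω) (hΩr : ∀ k ∈ K, ∀ g, g * k ∈ Ω ↔ g ∈ Ω) :
    μ (Ω ∩ {g | x * g * x⁻¹ ∈ Ω}) = μ (Ω ∩ {g | t * g * t⁻¹ ∈ Ω}) := by
  obtain ⟨k₀, k₁, hk₀, hk₁, rfl⟩ := exists_eq_mul_mul_of_mem_doubleCoset K t x hx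
  have hset : Ω ∩ {g | k₀ * t * k₁ * g * (k₀ * t * k₁)⁻¹ ∈ Ω} =
      (fun g => k₁ * g) ⁻¹' ((fun g => g * k₁⁻¹) ⁻¹' (Ω ∩ {g | t * g * t⁻¹ ∈ Ω})) := by
    ext g
    simp only [Set.mem_inter_iff, Set.mem_setOf_eq, Set.mem_preimage]
    have h1 : k₁ * g * k₁⁻¹ ∈ Ω ↔ g ∈ Ω := by
      rw [mul_assoc, hΩl k₁ hk₁ (g * k₁⁻¹), hΩr k₁⁻¹ (K.inv_mem hk₁) g]
    have h2 : k₀ * t * k₁ * g * (k₀ * t * k₁)⁻¹ ∈ Ω ↔ t * (k₁ * g * k₁⁻¹) * t⁻¹ ∈ Ω := by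
      have h := (hΩl k₀ hk₀ (t * (k₁ * g * k₁⁻¹) * t⁻¹ * k₀⁻¹)).trans (hΩr k₀⁻¹ (K.inv_mem hk₀) (t * (k₁ * g * k₁⁻¹) * t⁻¹))
      simpa [mul_assoc, mul_inv_rev] using h
    rw [h1, h2]
  rw [hset, measure_preimage_mul, measure_preimage_mul_right]

/-- **Monotone form for sub-boxes**: `A, S ⊆ Ω` with `Ω` `K`-bi-invariant, `x ∈ K t K` ⇒ `μ(A ∩ x⁻¹Sx) ≤ μ(Ω ∩ t⁻¹Ωt)`. [cite: Cartier1979, §I.3] -/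
theorem measure_inter_conjPreimage_le_of_mem_doubleCoset [MeasurableMul G] [μ.IsMulLeftInvariant] [μ.IsMulRightInvariant]
    (K : Subgroup G) (t x : G) (hx : x ∈ (K : Set G) * {t} * (K : Set G)) (Ω : Set G)
    (hΩl : ∀ k ∈ K, ∀ g, k * g ∈ Ω ↔ g ∈ Ω) (hΩr : ∀ k ∈ K, ∀ g, g * k ∈ Ω ↔ g ∈ Ω)
    {A S : Set G} (hA : A ⊆ Ω) (hS : S ⊆ Ω) :
    μ (A ∩ {g | x * g * x⁻¹ ∈ S}) ≤ μ (Ω ∩ {g | t * g * t⁻¹ ∈ Ω}) := by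
  rw [← measure_inter_conjPreimage_eq_of_mem_doubleCoset μ K t x hx Ω hΩl hΩr]
  exact measure_mono (Set.inter_subset_inter hA fun g hg => hS hg)

/-- **THE `d`-TH TERM OF (FC)** (glue to ★ K2E3-p23 (g4)'s (FC-8a) `∑' d, μ (D d) * ⨆ x ∈ D d, μ (A ∩ {g | x * g * x⁻¹ ∈ S})` with `D d = K t_d K`): for `G` second
countable locally compact unimodular, `K` an open subgroup, `Ω ⊆ ⋃_{f ∈ F} fK` a `K`-bi-invariant box containing `A` and `S`, and every `t`,
`μ(K t K) · sup_{x ∈ KtK} μ(A ∩ x⁻¹Sx) ≤ |F|² · μ(K)²`. [cite: Cartier1979, §I.3–I.4] [cite: BushnellHenniart2006, §4.1] -/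
theorem measure_doubleCoset_mul_iSup_le [TopologicalSpace G] [IsTopologicalGroup G] [BorelSpace G] [SecondCountableTopology G]
    [LocallyCompactSpace G] [μ.IsHaarMeasure] [μ.IsMulRightInvariant]
    (K : Subgroup G) (hKo : IsOpen (K : Set G)) (t : G) (Ω : Set G) (F : Finset G) (hΩ : Ω ⊆ ⋃ f ∈ F, f • (K : Set G))
    (hΩl : ∀ k ∈ K, ∀ g, k * g ∈ Ω ↔ g ∈ Ω) (hΩr : ∀ k ∈ K, ∀ g, g * k ∈ Ω ↔ g ∈ Ω) {A S : Set G} (hA : A ⊆ Ω) (hS : S ⊆ Ω) :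
    μ ((K : Set G) * {t} * (K : Set G)) * ⨆ x ∈ (K : Set G) * {t} * (K : Set G), μ (A ∩ {g | x * g * x⁻¹ ∈ S}) ≤
      (F.card : ℝ≥0∞) ^ 2 * μ K ^ 2 := by
  have hsup : ⨆ x ∈ (K : Set G) * {t} * (K : Set G), μ (A ∩ {g | x * g * x⁻¹ ∈ S}) ≤ μ (Ω ∩ {g | t * g * t⁻¹ ∈ Ω}) :=
    iSup₂_le fun x hx => measure_inter_conjPreimage_le_of_mem_doubleCoset μ K t x hx Ω hΩl hΩr hA hS
  calc μ ((K : Set G) * {t} * (K : Set G)) * ⨆ x ∈ (K : Set G) * {t} * (K : Set G), μ (A ∩ {g | x * g * x⁻¹ ∈ S})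
      ≤ μ ((K : Set G) * {t} * (K : Set G)) * μ (Ω ∩ {g | t * g * t⁻¹ ∈ Ω}) := mul_le_mul' le_rfl hsup
    _ ≤ (F.card : ℝ≥0∞) ^ 2 * μ K ^ 2 := measure_doubleCoset_mul_measure_box_le μ K hKo t Ω F hΩ

end BiInvariant

end Summit.HodgeConjecture.HodgeConjecture.Cruxes.H413.K2E3DoubleCosetBoxMeasure

end
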